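import Summits.ValiantsHypothesis.ValiantsHypothesis.Theorems.KPlusLogSqLawTropicalBTopHeavyCoreStructure
import Summits.ValiantsHypothesis.ValiantsHypothesis.Theorems.KPlusLogSqLawTropicalBLexCoreLaws
import Summits.ValiantsHypothesis.ValiantsHypothesis.Theorems.KPlusLogSqLawTropicalBLexCoreHall

/-!
# Route «KPlusLogSqLaw», crux `TropicalB` (stmt-ValiantsHypothesis-19771) — THE TOP-HEAVY CORE, part 3 (assembly): given the ONE-JUMP ARC, the
# three terms `c₁^{m−2}c₂²`, `c₁^{m−1}c₃`, `c₀^{m−1}c₄` cannot all be dominant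

HONEST FRAMING.  Third kernel part of this seat's located all-`m` «CORE LAW C» (val-sym-trop-p1 g21, cell `pub-symmetroid`, 2026-08-28; memo
HOME/val-sym-trop-p1/g21/CORE-LAW-C-g21.md = evidence on stmt-ValiantsHypothesis-19771; `--supports … --as helper`).  It reduces the law to ONE
combinatorial statement about the two permutations `σ_B⁻¹σ_C`, `σ_A⁻¹σ_B` (part 2, NOT in the tree yet: the existence of the «arc data» below, proved on
paper in the memo §3.4 by a winding-number count): from three dominant terms `P_A = (σA, λA)` (class `c₂` at `a₁ ≠ a₂`, `c₁` elsewhere),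
`P_B = (σB, λB)` (`c₃` at `b`, `c₁` elsewhere), `P_C = (σC, λC)` (`c₄` at `c`, `c₀` elsewhere) with `d c₀ < d c₁ < d c₂ < d c₃`, `P_C` latest, and a column
set `U ∋ c, j` with `b ∉ U ∖ {j}`, `U ≠ univ`, on which «`σB` off `j`, `σA` at `j`, `σC` off `U`» is injective (the ONE-JUMP TRANSVERSAL `Q₀`), we derive
`False` — by Kőnig's split of the remaining incidences (`LexCore.two_factor`) and the 3-body multi-exchange law in SUM form (`latin_contra_sum`, the
tree's `LexCore.latin_contra` with its column-wise domination hypothesis weakened to the sum it actually uses).  Nothing here bears on `TropicalB` in its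
window, `WeakLifting`, the doors, `MatrixDescartes` (stmt-ValiantsHypothesis-18050) or VP ≠ VNP.

* `latin_contra_sum` — `LexCore.latin_contra` with `hP1` in sum form.
* `core_of_arc` — **CORE LAW C GIVEN THE ARC**: the assembly described above.
[exchange argument; Kőnig 1916 / Hall; the packaging is this cell's]
-/

set_option linter.dupNamespace false
set_option autoImplicit false

namespace Summit.ValiantsHypothesis.ValiantsHypothesis.Theorems.KPlusLogSqLaw.TopHeavyCore

open Summit.ValiantsHypothesis.ValiantsHypothesis.Theorems.MatrixDescartes.Negative
open Summit.ValiantsHypothesis.ValiantsHypothesis.Theorems.KPlusLogSqLaw.LexCore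
open scoped BigOperators
open Finset

variable {m K : ℕ}

/-! ## 1. The 3-body law in sum form -/

/-- **3-body multi-exchange contradiction, sum form** — verbatim `LexCore.latin_contra` except that the first transversal is dominated by the
earliest term only in SUM (`Σ_b d(Q₀ b) ≤ Σ_b d(T₀ b)`), which is all its proof uses. [tree: `LexCore.latin_contra`; this repackaging] -/
theorem latin_contra_sum (d : Fin K → ℕ) (v ε : Fin m → Fin m → Fin K → ℤ) (T : Fin 3 → Equiv.Perm (Fin m) × (Fin m → Fin K))
    (θ3 : Fin 3 → ℤ) (h01 : θ3 0 < θ3 1) (h12 : θ3 1 < θ3 2) (hdom : ∀ k, IsDominant d v ε (θ3 k) (T k))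
    (s₀ s₁ s₂ : Fin m → Fin 3) (hd01 : ∀ b, s₀ b ≠ s₁ b) (hd02 : ∀ b, s₀ b ≠ s₂ b) (hd12 : ∀ b, s₁ b ≠ s₂ b)
    (hi₀ : Function.Injective fun b => (T (s₀ b)).1 b) (hi₁ : Function.Injective fun b => (T (s₁ b)).1 b)
    (hi₂ : Function.Injective fun b => (T (s₂ b)).1 b)
    (hne : ∃ b, (T (s₀ b)).1 b ≠ (T 0).1 b) (hP1 : ∑ b, (d ((T (s₀ b)).2 b) : ℤ) ≤ ∑ b, (d ((T 0).2 b) : ℤ))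
    (hP2 : ∑ b, (d ((T 2).2 b) : ℤ) ≤ ∑ b, (d ((T (s₂ b)).2 b) : ℤ)) : False := by
  classical
  -- the three transversal terms
  set Q₀ : Equiv.Perm (Fin m) × (Fin m → Fin K) :=
    (Equiv.ofBijective _ (Finite.injective_iff_bijective.mp hi₀), fun b => (T (s₀ b)).2 b) with hQ₀
  set Q₁ : Equiv.Perm (Fin m) × (Fin m → Fin K) :=
    (Equiv.ofBijective _ (Finite.injective_iff_bijective.mp hi₁), fun b => (T (s₁ b)).2 b) with hQ₁
  set Q₂ : Equiv.Perm (Fin m) × (Fin m → Fin K) :=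
    (Equiv.ofBijective _ (Finite.injective_iff_bijective.mp hi₂), fun b => (T (s₂ b)).2 b) with hQ₂
  have hQ₀1 : ∀ b, Q₀.1 b = (T (s₀ b)).1 b := fun b => by rw [hQ₀, Equiv.ofBijective_apply]
  have hQ₁1 : ∀ b, Q₁.1 b = (T (s₁ b)).1 b := fun b => by rw [hQ₁, Equiv.ofBijective_apply]
  have hQ₂1 : ∀ b, Q₂.1 b = (T (s₂ b)).1 b := fun b => by rw [hQ₂, Equiv.ofBijective_apply]
  have hQ₀2 : ∀ b, Q₀.2 b = (T (s₀ b)).2 b := fun b => rfl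
  have hQ₁2 : ∀ b, Q₁.2 b = (T (s₁ b)).2 b := fun b => rfl
  have hQ₂2 : ∀ b, Q₂.2 b = (T (s₂ b)).2 b := fun b => rfl
  -- ℕ-indexed families
  set P : ℕ → Equiv.Perm (Fin m) × (Fin m → Fin K) := fun j => if j = 0 then T 0 else if j = 1 then T 1 else T 2 with hP
  set Q : ℕ → Equiv.Perm (Fin m) × (Fin m → Fin K) := fun j => if j = 0 then Q₀ else if j = 1 then Q₁ else Q₂ with hQ
  set θ : ℕ → ℤ := fun j => if j = 0 then θ3 0 else if j = 1 then θ3 1 else θ3 2 with hθ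
  have P0 : P 0 = T 0 := by simp [hP]
  have P1 : P 1 = T 1 := by simp [hP]
  have P2 : P 2 = T 2 := by simp [hP]
  have Q0 : Q 0 = Q₀ := by simp [hQ]
  have Q1 : Q 1 = Q₁ := by simp [hQ]
  have Q2 : Q 2 = Q₂ := by simp [hQ]
  -- hypotheses of the multi-exchange law
  have hθ' : ∀ i, i + 1 < 3 → θ i ≤ θ (i + 1) := by
    intro i hi
    have : i = 0 ∨ i = 1 := by omega
    rcases this with rfl | rfl
    · simp [hθ]; exact h01.le
    · simp [hθ]; exact h12.le
  have hdom' : ∀ j, j < 3 → IsDominant d v ε (θ j) (P j) := by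
    intro j hj
    have : j = 0 ∨ j = 1 ∨ j = 2 := by omega
    rcases this with rfl | rfl | rfl
    · simp [hθ, hP]; exact hdom 0
    · simp [hθ, hP]; exact hdom 1
    · simp [hθ, hP]; exact hdom 2
  -- presence of the transversal terms
  have pres : ∀ (s : Fin m → Fin 3) (q : Equiv.Perm (Fin m) × (Fin m → Fin K)),
      (∀ b, q.1 b = (T (s b)).1 b) → (∀ b, q.2 b = (T (s b)).2 b) → termSign ε q ≠ 0 := by
    intro s q h1 h2
    have e : q = (q.1, q.2) := rfl
    rw [e]
    unfold termSign
    refine mul_ne_zero (Units.ne_zero _) (Finset.prod_ne_zero_iff.mpr fun b _ => ?_)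
    simp only
    rw [h1 b, h2 b]
    exact LacunarySymmetroidMatrixDescartes.TropicalCensus.present_of_termSign_ne_zero ε (T (s b)) (hdom (s b)).1 b
  have hQpres : ∀ j, j < 3 → termSign ε (Q j) ≠ 0 := by
    intro j hj
    have : j = 0 ∨ j = 1 ∨ j = 2 := by omega
    rcases this with rfl | rfl | rfl
    · rw [Q0]; exact pres s₀ Q₀ hQ₀1 hQ₀2
    · rw [Q1]; exact pres s₁ Q₁ hQ₁1 hQ₁2
    · rw [Q2]; exact pres s₂ Q₂ hQ₂1 hQ₂2
  -- `Q₀ ≠ T 0`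
  have hne' : ∃ j, j < 3 ∧ Q j ≠ P j := by
    obtain ⟨b, hb⟩ := hne
    refine ⟨0, by omega, fun h => hb ?_⟩
    rw [Q0, P0] at h
    rw [← hQ₀1 b, h]
  -- incidence counts agree column by column
  have hinc : ∀ (b : Fin m) (al : Fin m × Fin K),
      ((range 3).filter fun j => ((P j).1 b, (P j).2 b) = al).card =
        ((range 3).filter fun j => ((Q j).1 b, (Q j).2 b) = al).card := by
    intro b al
    rw [LexCore.card_filter_range_three (fun j => ((P j).1 b, (P j).2 b)) al, LexCore.card_filter_range_three (fun j => ((Q j).1 b, (Q j).2 b)) al]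
    simp only [P0, P1, P2, Q0, Q1, Q2, hQ₀1, hQ₁1, hQ₂1, hQ₀2, hQ₁2, hQ₂2]
    have key := LexCore.perm3_sum (fun s => if (((T s).1 b, (T s).2 b) : Fin m × Fin K) = al then 1 else 0) (s₀ b) (s₁ b) (s₂ b)
      (hd01 b) (hd02 b) (hd12 b)
    omega
  -- the multi-exchange law
  obtain ⟨j, hj, hlt⟩ := MultiExchange.prefix_deficit d v ε 3 θ P Q hθ' hdom' hQpres hne' hinc
  have hS := MultiExchange.sum_sum_eq_of_count_eq 3 P Q hinc fun _ al => (d al.2 : ℤ)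
  simp only [Finset.sum_range_succ, Finset.sum_range_zero, zero_add, P0, P1, P2, Q0, Q1, Q2] at hS
  have hj' : j = 0 ∨ j = 1 := by omega
  rcases hj' with rfl | rfl
  · -- prefix of length one: `S(T 0) < S(Q₀)`, against the column-wise domination
    simp only [zero_add, Finset.sum_range_one, P0, Q0] at hlt
    have hge : ∑ b, (d (Q₀.2 b) : ℤ) ≤ ∑ b, (d ((T 0).2 b) : ℤ) := by
      have : ∑ b, (d (Q₀.2 b) : ℤ) = ∑ b, (d ((T (s₀ b)).2 b) : ℤ) := Finset.sum_congr rfl fun b _ => by rw [hQ₀2 b]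
      rw [this]; exact hP1
    exact absurd hlt (not_lt.mpr hge)
  · -- prefix of length two: `S(Q₂) < S(T 2)`, against `hP2`
    simp only [Finset.sum_range_succ, Finset.sum_range_zero, zero_add, P0, P1, Q0, Q1] at hlt
    have hQ2sum : ∑ b, (d (Q₂.2 b) : ℤ) = ∑ b, (d ((T (s₂ b)).2 b) : ℤ) := Finset.sum_congr rfl fun b _ => by rw [hQ₂2 b]
    linarith

/-! ## 2. Assembly: the one-jump transversal closes the argument -/

/-- `Fin 3` bookkeeping: the third slot. -/
theorem fin3_third (u w z : Fin 3) (h1 : w ≠ u) (h2 : z ≠ u) (h3 : w ≠ z) (hu : u ≠ 2) (hz : z ≠ 2) : w = 2 := by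
  revert u w z; decide

/-- `Fin 3` bookkeeping: `0` is one of two distinct non-`2` slots. -/
theorem fin3_zero (iA iB : Fin 3) (hA : iA ≠ 2) (hB : iB ≠ 2) (hAB : iA ≠ iB) : (0 : Fin 3) = iA ∨ (0 : Fin 3) = iB := by
  revert iA iB; decide

/-- `Fin 3` bookkeeping. -/
theorem fin3_one (iA iB : Fin 3) (hA : iA ≠ 2) (hAB : iA ≠ iB) (h0 : (0 : Fin 3) = iB) : iA = 1 := by
  revert iA iB; decide

/-- **CORE LAW C, GIVEN THE ARC.**  Three dominant terms of the top-heavy core shapes, `P_C` latest, exponents `d c₀ < d c₁ < d c₂ < d c₃`, and ONE-JUMP ARC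
DATA `(U, j)`: `c, j ∈ U`, `b ∉ U ∖ {j}`, `U ≠ univ`, and the column-to-row map «`σC` off `U`, `σB` on `U ∖ {j}`, `σA` at `j`» injective.  Then `False`.
[this cell] -/
theorem core_of_arc (d : Fin K → ℕ) (v ε : Fin m → Fin m → Fin K → ℤ) (hm : 2 ≤ m)
    {c₀ c₁ c₂ c₃ c₄ : Fin K} (h01 : d c₀ < d c₁) (h12 : d c₁ < d c₂) (h23 : d c₂ < d c₃)
    {σA σB σC : Equiv.Perm (Fin m)} {lA lB lC : Fin m → Fin K} {a₁ a₂ b c : Fin m}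
    (hlA : ∀ x, lA x = if x = a₁ ∨ x = a₂ then c₂ else c₁) (hlB : ∀ x, lB x = if x = b then c₃ else c₁)
    (hlC : ∀ x, lC x = if x = c then c₄ else c₀) (hmin : ∀ l, d c₀ ≤ d l)
    {θA θB θC : ℤ} (hA : IsDominant d v ε θA (σA, lA)) (hB : IsDominant d v ε θB (σB, lB)) (hC : IsDominant d v ε θC (σC, lC))
    (hAC : θA < θC) (hBC : θB < θC) (hAB : θA ≠ θB)
    (U : Finset (Fin m)) (j : Fin m) (hjU : j ∈ U) (hcU : c ∈ U) (hbU : b ∉ U ∨ b = j) (hUne : U ≠ univ)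
    (hinj : Function.Injective fun x => if x ∈ U then (if x = j then σA x else σB x) else σC x) : False := by
  classical
  -- exponent facts
  have hlA_ge : ∀ x, d c₁ ≤ d (lA x) := fun x => by rw [hlA x]; split_ifs <;> omega
  have hlB_ge : ∀ x, d c₁ ≤ d (lB x) := fun x => by rw [hlB x]; split_ifs <;> omega
  have hlA_le : ∀ x, d (lA x) ≤ d c₂ := fun x => by rw [hlA x]; split_ifs <;> omega
  -- a column outside `U`
  obtain ⟨x₀, hx₀⟩ : ∃ x, x ∉ U := by
    by_contra h; push Not at h; exact hUne (Finset.eq_univ_of_forall h)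
  -- quotients against `C` are fixed-point free
  have hfA := (hamiltonian_AC d v ε hAC hA hC c (c₀ := c₀) (fun x hx => by rw [hlC x, if_neg hx])
    (fun x => lt_of_lt_of_le h01 (hlA_ge x)) hm).1
  have hfB := (hamiltonian_AC d v ε hBC hB hC c (c₀ := c₀) (fun x hx => by rw [hlC x, if_neg hx])
    (fun x => lt_of_lt_of_le h01 (hlB_ge x)) hm).1
  have hCA : ∀ x, σC x ≠ σA x := fun x h => hfA x (by
    rw [Equiv.Perm.mul_apply, Equiv.Perm.inv_eq_iff_eq]; exact h)
  have hCB : ∀ x, σC x ≠ σB x := fun x h => hfB x (by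
    rw [Equiv.Perm.mul_apply, Equiv.Perm.inv_eq_iff_eq]; exact h)
  -- order the three terms: `T 2 = C`, `T iA = A`, `T iB = B`
  obtain ⟨iA, iB, T, θ3, hT2, hTA, hTB, hiA2, hiB2, hiAB, hθ01, hθ12, hdomT, hθA, hθB⟩ :
      ∃ (iA iB : Fin 3) (T : Fin 3 → Equiv.Perm (Fin m) × (Fin m → Fin K)) (θ3 : Fin 3 → ℤ),
        T 2 = (σC, lC) ∧ T iA = (σA, lA) ∧ T iB = (σB, lB) ∧ iA ≠ 2 ∧ iB ≠ 2 ∧ iA ≠ iB ∧ θ3 0 < θ3 1 ∧ θ3 1 < θ3 2 ∧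
        (∀ k, IsDominant d v ε (θ3 k) (T k)) ∧ θ3 iA = θA ∧ θ3 iB = θB := by
    rcases lt_or_gt_of_ne hAB with hlt | hgt
    · refine ⟨0, 1, ![(σA, lA), (σB, lB), (σC, lC)], ![θA, θB, θC], rfl, rfl, rfl, by decide, by decide, by decide, ?_, ?_, ?_, rfl, rfl⟩
      · simpa using hlt
      · simpa using hBC
      · intro k; fin_cases k <;> simpa
    · refine ⟨1, 0, ![(σB, lB), (σA, lA), (σC, lC)], ![θB, θA, θC], rfl, rfl, rfl, by decide, by decide, by decide, ?_, ?_, ?_, rfl, rfl⟩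
      · simpa using hgt
      · simpa using hAC
      · intro k; fin_cases k <;> simpa
  -- the selector of the one-jump transversal
  let s₀ : Fin m → Fin 3 := fun x => if x ∈ U then (if x = j then iA else iB) else 2
  have hs₀row : ∀ x, (T (s₀ x)).1 x = (if x ∈ U then (if x = j then σA x else σB x) else σC x) := by
    intro x
    by_cases hx : x ∈ U
    · by_cases hxj : x = j
      · simp only [s₀, if_pos hx, if_pos hxj, hTA]
      · simp only [s₀, if_pos hx, if_neg hxj, hTB]
    · simp only [s₀, if_neg hx, hT2]
  have hs₀cls : ∀ x, (T (s₀ x)).2 x = (if x ∈ U then (if x = j then lA x else lB x) else lC x) := by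
    intro x
    by_cases hx : x ∈ U
    · by_cases hxj : x = j
      · simp only [s₀, if_pos hx, if_pos hxj, hTA]
      · simp only [s₀, if_pos hx, if_neg hxj, hTB]
    · simp only [s₀, if_neg hx, hT2]
  have hi₀ : Function.Injective fun x => (T (s₀ x)).1 x := by
    have : (fun x => (T (s₀ x)).1 x) = fun x => if x ∈ U then (if x = j then σA x else σB x) else σC x := funext hs₀row
    rw [this]; exact hinj
  -- rows of the three terms are injective
  have hr : ∀ s, Function.Injective fun x => (T s).1 x := fun s => (T s).1.injective
  -- Kőnig: split the free incidences
  obtain ⟨s₁', s₂', h1M, h2M, h12', hi₁', hi₂'⟩ := LexCore.two_factor (fun s x => (T s).1 x) hr s₀ hi₀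
  -- arrange that the second free transversal takes the `c₄`-cell at column `c`
  obtain ⟨s₁, s₂, h01s, h02s, h12s, hi₁, hi₂, hs₂c⟩ : ∃ s₁ s₂ : Fin m → Fin 3, (∀ x, s₀ x ≠ s₁ x) ∧ (∀ x, s₀ x ≠ s₂ x) ∧ (∀ x, s₁ x ≠ s₂ x) ∧
      Function.Injective (fun x => (T (s₁ x)).1 x) ∧ Function.Injective (fun x => (T (s₂ x)).1 x) ∧ s₂ c = 2 := by
    have hs₀c : s₀ c ≠ 2 := by
      simp only [s₀, if_pos hcU]; split_ifs <;> assumption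
    by_cases h2 : s₂' c = 2
    · exact ⟨s₁', s₂', fun x => (h1M x).symm, fun x => (h2M x).symm, h12', hi₁', hi₂', h2⟩
    · have h1 : s₁' c = 2 := fin3_third (s₀ c) (s₁' c) (s₂' c) (h1M c) (h2M c) (h12' c) hs₀c h2
      exact ⟨s₂', s₁', fun x => (h2M x).symm, fun x => (h1M x).symm, fun x => (h12' x).symm, hi₂', hi₁', h1⟩
  -- `Q₀ ≠ T 0` at the column `x₀ ∉ U`
  have hneQ : ∃ x, (T (s₀ x)).1 x ≠ (T 0).1 x := by
    refine ⟨x₀, ?_⟩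
    rw [hs₀row x₀, if_neg hx₀]
    -- `T 0` is `A` or `B`
    have h0 : (0 : Fin 3) = iA ∨ (0 : Fin 3) = iB := fin3_zero iA iB hiA2 hiB2 hiAB
    rcases h0 with h | h
    · rw [h, hTA]; exact hCA x₀
    · rw [h, hTB]; exact hCB x₀
  -- domination of `Q₀` by the earliest term, in sum
  have hP1 : ∑ x, (d ((T (s₀ x)).2 x) : ℤ) ≤ ∑ x, (d ((T 0).2 x) : ℤ) := by
    have hb' : ∀ x, x ∈ U → x ≠ j → x ≠ b := by
      intro x hx hxj hxb; rcases hbU with h | h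
      · exact h (hxb ▸ hx)
      · exact hxj (hxb.trans h)
    -- pointwise value of `Q₀`'s exponent
    have hQ : ∀ x, (d ((T (s₀ x)).2 x) : ℤ) = if x ∈ U then (if x = j then (d (lA j) : ℤ) else d c₁) else d c₀ := by
      intro x
      rw [hs₀cls x]
      by_cases hx : x ∈ U
      · by_cases hxj : x = j
        · rw [if_pos hx, if_pos hxj, if_pos hx, if_pos hxj, hxj]
        · rw [if_pos hx, if_neg hxj, if_pos hx, if_neg hxj, hlB x, if_neg (hb' x hx hxj)]
      · have hxc : x ≠ c := fun h => hx (h ▸ hcU)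
        rw [if_neg hx, if_neg hx, hlC x, if_neg hxc]
    have h0 : (0 : Fin 3) = iA ∨ (0 : Fin 3) = iB := fin3_zero iA iB hiA2 hiB2 hiAB
    rcases h0 with h | h
    · -- earliest term is `A`: pointwise domination
      rw [h, hTA]
      refine Finset.sum_le_sum fun x _ => ?_
      rw [hQ x]
      by_cases hx : x ∈ U
      · by_cases hxj : x = j
        · rw [if_pos hx, if_pos hxj, hxj]
        · rw [if_pos hx, if_neg hxj]; exact_mod_cast hlA_ge x
      · rw [if_neg hx]; exact_mod_cast (hmin (lA x))
    · -- earliest term is `B`: `θB < θA`; pair the deficit at `j` with the surplus at `b`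
      rw [h, hTB]
      by_cases hjb : j = b
      · -- `Q₀` is pointwise dominated by `B` as well
        refine Finset.sum_le_sum fun x _ => ?_
        rw [hQ x]
        by_cases hx : x ∈ U
        · by_cases hxj : x = j
          · rw [if_pos hx, if_pos hxj]
            change (d (lA j) : ℤ) ≤ (d (lB x) : ℤ)
            rw [hlB x, if_pos (hxj.trans hjb), hlA j]
            split_ifs
            · exact_mod_cast h23.le
            · exact_mod_cast (h12.trans h23).le
          · rw [if_pos hx, if_neg hxj]; exact_mod_cast hlB_ge x
        · rw [if_neg hx]; exact_mod_cast (hmin (lB x))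
      · -- `b ∉ U`: compare outside the two columns `j`, `b` pointwise, and at `{j, b}` jointly
        have hbU' : b ∉ U := by rcases hbU with h' | h'; exact h'; exact absurd h'.symm hjb
        have hjb' : j ≠ b := hjb
        -- split both sums at `j` and `b`
        have splitQ := Finset.add_sum_erase (univ : Finset (Fin m)) (fun x => (d ((T (s₀ x)).2 x) : ℤ)) (Finset.mem_univ j)
        have splitB := Finset.add_sum_erase (univ : Finset (Fin m)) (fun x => (d (lB x) : ℤ)) (Finset.mem_univ j)
        have hbmem : b ∈ (univ : Finset (Fin m)).erase j := Finset.mem_erase.mpr ⟨hjb'.symm, Finset.mem_univ b⟩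
        have splitQ' := Finset.add_sum_erase ((univ : Finset (Fin m)).erase j) (fun x => (d ((T (s₀ x)).2 x) : ℤ)) hbmem
        have splitB' := Finset.add_sum_erase ((univ : Finset (Fin m)).erase j) (fun x => (d (lB x) : ℤ)) hbmem
        have hrest : ∑ x ∈ ((univ : Finset (Fin m)).erase j).erase b, (d ((T (s₀ x)).2 x) : ℤ) ≤
            ∑ x ∈ ((univ : Finset (Fin m)).erase j).erase b, (d (lB x) : ℤ) := by
          refine Finset.sum_le_sum fun x hx => ?_
          have hxb : x ≠ b := Finset.ne_of_mem_erase hx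
          have hxj : x ≠ j := Finset.ne_of_mem_erase (Finset.mem_of_mem_erase hx)
          rw [hQ x]
          by_cases hxU : x ∈ U
          · rw [if_pos hxU, if_neg hxj]; exact_mod_cast hlB_ge x
          · rw [if_neg hxU]; exact_mod_cast hmin (lB x)
        have hQj : (d ((T (s₀ j)).2 j) : ℤ) ≤ d c₂ := by rw [hQ j, if_pos hjU, if_pos rfl]; exact_mod_cast hlA_le j
        have hQb : (d ((T (s₀ b)).2 b) : ℤ) = d c₀ := by rw [hQ b, if_neg hbU']
        have hBj : (d (lB j) : ℤ) = d c₁ := by rw [hlB j, if_neg hjb']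
        have hBb : (d (lB b) : ℤ) = d c₃ := by rw [hlB b, if_pos rfl]
        have e1 : (d c₀ : ℤ) < d c₁ := by exact_mod_cast h01
        have e3 : (d c₂ : ℤ) < d c₃ := by exact_mod_cast h23
        show ∑ x, (d ((T (s₀ x)).2 x) : ℤ) ≤ ∑ x, (d ((σB, lB).2 x) : ℤ)
        simp only
        linarith
  -- domination of the last term by the transversal through the `c₄`-cell, pointwise
  have hP2 : ∑ x, (d ((T 2).2 x) : ℤ) ≤ ∑ x, (d ((T (s₂ x)).2 x) : ℤ) := by
    refine Finset.sum_le_sum fun x _ => ?_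
    rw [hT2]
    by_cases hxc : x = c
    · subst hxc; rw [hs₂c, hT2]
    · simp only
      rw [hlC x, if_neg hxc]
      exact_mod_cast hmin _
  exact latin_contra_sum d v ε T θ3 hθ01 hθ12 hdomT s₀ s₁ s₂ h01s h02s h12s hi₀ hi₁ hi₂ hneQ hP1 hP2

end Summit.ValiantsHypothesis.ValiantsHypothesis.Theorems.KPlusLogSqLaw.TopHeavyCore
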